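import Summits.KontsevichZagierPeriods.KontsevichZagierPeriods.Theorems.TorsionLogsTorsionSectorCompleteArcFubini
import HarnessLib

/-!
# Route `TorsionLogs`, crux `TorsionSectorComplete` (stmt-KontsevichZagierPeriods-14212), line
# `NeronTorsionModularArc` — the two fibred representations of the arc: values as `t`-integrals

Continuation of `TorsionLogsTorsionSectorCompleteArcFubini.lean` (last-coordinate slice Fubini, raw fibre
values), specialised to the domain SHAPES of `ArcReps` in
`Cruxes/TorsionSectorComplete/Lines/NeronTorsionModularArc.lean` (parameter `t = z 2` LAST):

* the slices over a parameter `s` of the fibred triangle `{t₀ < z₂ < t₁, e₁ < z₁ < z₀ < x_P(z₂)}` (the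
  domain of `R_I`, verbatim) and of the fibred quadrant `{t₀ < z₂ < t₁, e₁ < z₀, e₁ < z₁}` (the domain of
  `R_P`, verbatim): `lastSlice_arcTriangle_of_mem` / `_of_not_mem`, `lastSlice_arcQuadrant_of_mem` / …;
* `value_arcTriangle_eq`: for ANY `R : KZ.IntegralRep 3` with that domain and integrand
  `z₁/(√g(z₂,z₁)√g(z₂,z₀))` on it, `R.value = ∫_{t₀}^{t₁} I_raw(t) dt` with
  `I_raw(t) = ∫_{e₁}^{x_P(t)} (∫_{e₁}^{a} b/√g(t,b) db)(√g(t,a))⁻¹ da` (the raw form in which the landed fibre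
  identity `neronTorsion_value_identity` reads `rI.value` through `value_triangle_eq`), AND `I_raw` is
  integrable on the arc (a.e.-slice integrability from Fubini + `setIntegral_triangle_eq`);
* `value_arcQuadrant_eq`: likewise `R.value = ∫_{t₀}^{t₁} (∫_{e₁}^{∞} φ(t,·))(∫_{e₁}^{∞} ψ(t,·)) dt` for a
  product integrand, with integrability on the arc.

With `value_logBox_eq` / `integrableOn_log_of_logBox` (same file) these turn the modular-arc value identity
`ArcValueIdentity` into `∫_{t₀}^{t₁} (fibre identity) dt = 0`, all four `t`-integrands integrable.
Pure measure theory. prover-fwd2-land-3-g27-0 (on-path lander, assist on candidates row idx 8), 2026-08-19.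
[cite: KontsevichZagier2001, §1.1]
-/

-- single-conjunct summit: Sub = Summit, so the namespace segment repeats by design (CONVENTIONS §2)
set_option linter.dupNamespace false

noncomputable section

open Set MeasureTheory
open Literature.NumberTheory.Transcendental
namespace Summit.KontsevichZagierPeriods.KontsevichZagierPeriods.TorsionLogs.NeronTorsionModularArc

/-! ### Slices of the two fibred domains of `ArcReps` (parameter `t = z 2` last; coordinates of
`Fin.snoc x s : ℝ³` are `x 0, x 1, s` by `rfl`) -/

section Fibred

variable {e₁ t₀ t₁ : ℝ} {xP : ℝ → ℝ}

/-- The slice of the fibred triangle `{t₀ < z₂ < t₁, e₁ < z₁ < z₀ < x_P(z₂)}` (the domain of `R_I` in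
`ArcReps`, verbatim) over a parameter `s` of the arc is the fibre triangle `{e₁ < x₁ < x₀ < x_P(s)}`. -/
theorem lastSlice_arcTriangle_of_mem {s : ℝ} (hs : s ∈ Ioo t₀ t₁) :
    {x : Fin 2 → ℝ | (Fin.snoc x s : Fin 3 → ℝ) ∈
        {z : Fin 3 → ℝ | t₀ < z 2 ∧ z 2 < t₁ ∧ e₁ < z 1 ∧ z 1 < z 0 ∧ z 0 < xP (z 2)}} =
      {x : Fin 2 → ℝ | e₁ < x 1 ∧ x 1 < x 0 ∧ x 0 < xP s} := by
  have e0 : ∀ (x : Fin 2 → ℝ) (s : ℝ), (Fin.snoc x s : Fin 3 → ℝ) 0 = x 0 := fun _ _ => rfl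
  have e1 : ∀ (x : Fin 2 → ℝ) (s : ℝ), (Fin.snoc x s : Fin 3 → ℝ) 1 = x 1 := fun _ _ => rfl
  have e2 : ∀ (x : Fin 2 → ℝ) (s : ℝ), (Fin.snoc x s : Fin 3 → ℝ) 2 = s := fun _ _ => rfl
  ext x
  simp only [mem_setOf_eq, e0, e1, e2]
  exact ⟨fun h => h.2.2, fun h => ⟨hs.1, hs.2, h⟩⟩

/-- Off the arc the slice of the fibred triangle is empty. -/
theorem lastSlice_arcTriangle_of_not_mem {s : ℝ} (hs : s ∉ Ioo t₀ t₁) :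
    {x : Fin 2 → ℝ | (Fin.snoc x s : Fin 3 → ℝ) ∈
        {z : Fin 3 → ℝ | t₀ < z 2 ∧ z 2 < t₁ ∧ e₁ < z 1 ∧ z 1 < z 0 ∧ z 0 < xP (z 2)}} = ∅ := by
  have e2 : ∀ (x : Fin 2 → ℝ) (s : ℝ), (Fin.snoc x s : Fin 3 → ℝ) 2 = s := fun _ _ => rfl
  ext x
  simp only [mem_setOf_eq, e2, mem_empty_iff_false, iff_false, not_and]
  exact fun h1 h2 => absurd (And.intro h1 h2) hs

/-- The slice of the fibred quadrant `{t₀ < z₂ < t₁, e₁ < z₀, e₁ < z₁}` (the domain of `R_P` in `ArcReps`,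
verbatim) over a parameter `s` of the arc is the fibre quadrant `{e₁ < x₀, e₁ < x₁}`. -/
theorem lastSlice_arcQuadrant_of_mem {s : ℝ} (hs : s ∈ Ioo t₀ t₁) :
    {x : Fin 2 → ℝ | (Fin.snoc x s : Fin 3 → ℝ) ∈
        {z : Fin 3 → ℝ | t₀ < z 2 ∧ z 2 < t₁ ∧ e₁ < z 0 ∧ e₁ < z 1}} =
      {x : Fin 2 → ℝ | e₁ < x 0 ∧ e₁ < x 1} := by
  have e0 : ∀ (x : Fin 2 → ℝ) (s : ℝ), (Fin.snoc x s : Fin 3 → ℝ) 0 = x 0 := fun _ _ => rfl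
  have e1 : ∀ (x : Fin 2 → ℝ) (s : ℝ), (Fin.snoc x s : Fin 3 → ℝ) 1 = x 1 := fun _ _ => rfl
  have e2 : ∀ (x : Fin 2 → ℝ) (s : ℝ), (Fin.snoc x s : Fin 3 → ℝ) 2 = s := fun _ _ => rfl
  ext x
  simp only [mem_setOf_eq, e0, e1, e2]
  exact ⟨fun h => h.2.2, fun h => ⟨hs.1, hs.2, h⟩⟩

/-- Off the arc the slice of the fibred quadrant is empty. -/
theorem lastSlice_arcQuadrant_of_not_mem {s : ℝ} (hs : s ∉ Ioo t₀ t₁) :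
    {x : Fin 2 → ℝ | (Fin.snoc x s : Fin 3 → ℝ) ∈
        {z : Fin 3 → ℝ | t₀ < z 2 ∧ z 2 < t₁ ∧ e₁ < z 0 ∧ e₁ < z 1}} = ∅ := by
  have e2 : ∀ (x : Fin 2 → ℝ) (s : ℝ), (Fin.snoc x s : Fin 3 → ℝ) 2 = s := fun _ _ => rfl
  ext x
  simp only [mem_setOf_eq, e2, mem_empty_iff_false, iff_false, not_and]
  exact fun h1 h2 => absurd (And.intro h1 h2) hs

/-- A function of the parameter vanishing off the arc integrates over `ℝ` as over the arc. [folklore] -/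
theorem integral_eq_setIntegral_arc {Φ : ℝ → ℝ}
    (hΦ : ∀ s, s ∉ Ioo t₀ t₁ → Φ s = 0) : ∫ s, Φ s = ∫ s in Ioo t₀ t₁, Φ s :=
  (setIntegral_eq_integral_of_forall_compl_eq_zero fun s hs => hΦ s hs).symm

/-! ### Values of the two fibred representations as `t`-integrals of raw fibre values -/

/-- **Value of the fibred triangle representation `R_I` as a `t`-integral of raw fibre triangles**, with
integrability of the fibre-value function on the arc: if
`R.domain = {t₀ < z₂ < t₁, e₁ < z₁ < z₀ < x_P(z₂)}` and `R.integrand = z₁/(√g(z₂,z₁) √g(z₂,z₀))` on it, then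
`R.value = ∫_{t₀}^{t₁} (∫_{e₁}^{x_P(t)} (∫_{e₁}^{a} b/√g(t,b) db)(√g(t,a))⁻¹ da) dt`. [folklore] -/
theorem value_arcTriangle_eq (g : ℝ → ℝ → ℝ) (R : KZ.IntegralRep 3)
    (hdom : R.domain = {z : Fin 3 → ℝ | t₀ < z 2 ∧ z 2 < t₁ ∧ e₁ < z 1 ∧ z 1 < z 0 ∧ z 0 < xP (z 2)})
    (hint : EqOn R.integrand
      (fun z => z 1 / (Real.sqrt (g (z 2) (z 1)) * Real.sqrt (g (z 2) (z 0)))) R.domain) :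
    R.value = ∫ t in Ioo t₀ t₁, ∫ a in Ioo e₁ (xP t),
        (∫ b in Ioo e₁ a, b / Real.sqrt (g t b)) * (Real.sqrt (g t a))⁻¹ ∧
      IntegrableOn (fun t => ∫ a in Ioo e₁ (xP t),
        (∫ b in Ioo e₁ a, b / Real.sqrt (g t b)) * (Real.sqrt (g t a))⁻¹) (Ioo t₀ t₁) := by
  have e0 : ∀ (x : Fin 2 → ℝ) (s : ℝ), (Fin.snoc x s : Fin 3 → ℝ) 0 = x 0 := fun _ _ => rfl
  have e1 : ∀ (x : Fin 2 → ℝ) (s : ℝ), (Fin.snoc x s : Fin 3 → ℝ) 1 = x 1 := fun _ _ => rfl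
  have e2 : ∀ (x : Fin 2 → ℝ) (s : ℝ), (Fin.snoc x s : Fin 3 → ℝ) 2 = s := fun _ _ => rfl
  have hD : MeasurableSet R.domain := KZ.IntegralRep.measurableSet_domain_holds R
  -- the slice set-integral function
  set Φ : ℝ → ℝ := fun s =>
    ∫ x in {x : Fin 2 → ℝ | (Fin.snoc x s : Fin 3 → ℝ) ∈ R.domain}, R.integrand (Fin.snoc x s) with hΦ
  have hΦint : Integrable Φ := integrable_integral_lastSlice hD R.integrableOn
  have hΦval : ∫ s, Φ s = R.value := integral_integral_lastSlice hD R.integrableOn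
  have hΦzero : ∀ s, s ∉ Ioo t₀ t₁ → Φ s = 0 := by
    intro s hs
    simp only [hΦ, hdom, lastSlice_arcTriangle_of_not_mem hs, Measure.restrict_empty,
      integral_zero_measure]
  -- a.e. on the arc the slice integral is the raw fibre triangle
  have hae : ∀ᵐ s ∂(volume.restrict (Ioo t₀ t₁)), Φ s = ∫ a in Ioo e₁ (xP s),
      (∫ b in Ioo e₁ a, b / Real.sqrt (g s b)) * (Real.sqrt (g s a))⁻¹ := by
    filter_upwards [ae_restrict_of_ae (ae_integrableOn_lastSlice hD R.integrableOn),
      ae_restrict_mem measurableSet_Ioo] with s hs hsI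
    rw [hdom, lastSlice_arcTriangle_of_mem hsI] at hs
    simp only [hΦ, hdom, lastSlice_arcTriangle_of_mem hsI]
    refine setIntegral_triangle_eq (xP s) e₁ (g s) _ hs fun x hx => ?_
    have hx' : (Fin.snoc x s : Fin 3 → ℝ) ∈ R.domain := by
      rw [hdom]; exact ⟨hsI.1, hsI.2, hx⟩
    simp only [hint hx', e0, e1, e2]
  refine ⟨?_, ?_⟩
  · rw [← hΦval, integral_eq_setIntegral_arc hΦzero]
    exact integral_congr_ae hae
  · exact hΦint.integrableOn.congr_fun_ae (s := Ioo t₀ t₁) hae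

/-- **Value of the fibred quadrant representation `R_P` as a `t`-integral of products of raw fibre
integrals**, with integrability on the arc: if `R.domain = {t₀ < z₂ < t₁, e₁ < z₀, e₁ < z₁}` and
`R.integrand = φ(z₂, z₀) ψ(z₂, z₁)` on it, then
`R.value = ∫_{t₀}^{t₁} (∫_{e₁}^{∞} φ(t,a) da)(∫_{e₁}^{∞} ψ(t,b) db) dt`. [folklore] -/
theorem value_arcQuadrant_eq (φ ψ : ℝ → ℝ → ℝ) (R : KZ.IntegralRep 3)
    (hdom : R.domain = {z : Fin 3 → ℝ | t₀ < z 2 ∧ z 2 < t₁ ∧ e₁ < z 0 ∧ e₁ < z 1})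
    (hint : EqOn R.integrand (fun z => φ (z 2) (z 0) * ψ (z 2) (z 1)) R.domain) :
    R.value = ∫ t in Ioo t₀ t₁, (∫ a in Ioi e₁, φ t a) * (∫ b in Ioi e₁, ψ t b) ∧
      IntegrableOn (fun t => (∫ a in Ioi e₁, φ t a) * (∫ b in Ioi e₁, ψ t b)) (Ioo t₀ t₁) := by
  have e0 : ∀ (x : Fin 2 → ℝ) (s : ℝ), (Fin.snoc x s : Fin 3 → ℝ) 0 = x 0 := fun _ _ => rfl
  have e1 : ∀ (x : Fin 2 → ℝ) (s : ℝ), (Fin.snoc x s : Fin 3 → ℝ) 1 = x 1 := fun _ _ => rfl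
  have e2 : ∀ (x : Fin 2 → ℝ) (s : ℝ), (Fin.snoc x s : Fin 3 → ℝ) 2 = s := fun _ _ => rfl
  have hD : MeasurableSet R.domain := KZ.IntegralRep.measurableSet_domain_holds R
  set Φ : ℝ → ℝ := fun s =>
    ∫ x in {x : Fin 2 → ℝ | (Fin.snoc x s : Fin 3 → ℝ) ∈ R.domain}, R.integrand (Fin.snoc x s) with hΦ
  have hΦint : Integrable Φ := integrable_integral_lastSlice hD R.integrableOn
  have hΦval : ∫ s, Φ s = R.value := integral_integral_lastSlice hD R.integrableOn
  have hΦzero : ∀ s, s ∉ Ioo t₀ t₁ → Φ s = 0 := by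
    intro s hs
    simp only [hΦ, hdom, lastSlice_arcQuadrant_of_not_mem hs, Measure.restrict_empty,
      integral_zero_measure]
  have heq : ∀ s ∈ Ioo t₀ t₁, Φ s = (∫ a in Ioi e₁, φ s a) * (∫ b in Ioi e₁, ψ s b) := by
    intro s hsI
    simp only [hΦ, hdom, lastSlice_arcQuadrant_of_mem hsI]
    refine setIntegral_quadrant_eq e₁ e₁ (φ s) (ψ s) _ fun x hx => ?_
    have hx' : (Fin.snoc x s : Fin 3 → ℝ) ∈ R.domain := by
      rw [hdom]; exact ⟨hsI.1, hsI.2, hx⟩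
    simp only [hint hx', e0, e1, e2]
  refine ⟨?_, ?_⟩
  · rw [← hΦval, integral_eq_setIntegral_arc hΦzero]
    exact setIntegral_congr_fun measurableSet_Ioo heq
  · exact hΦint.integrableOn.congr_fun heq measurableSet_Ioo

end Fibred

end Summit.KontsevichZagierPeriods.KontsevichZagierPeriods.TorsionLogs.NeronTorsionModularArc

end
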